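import Literature.AlgebraicGeometry.Frobenioids.PerfectionRational
import Literature.AlgebraicGeometry.Frobenioids.Isotropification
import Literature.AlgebraicGeometry.Frobenioids.DivisorMonoidIsoDescent
import Literature.AlgebraicGeometry.Frobenioids.ElementaryIsomorphisms
import HarnessLib

/-!
# Frobenioids I, Remark 4.5.1: "if `C` is of rationally standard type …, then so is `C^istr`" — the
# RATIONAL-TYPE conjunct (Def. 4.5 (ii)) passes to the isotropification (PROVED)

Mochizuki, *The geometry of Frobenioids I: the general theory*, Kyushu J. Math. **62** (2008) 293–400,
Remark 4.5.1, Kyushu p. 368 (kurims p. 86) [cite: MochizukiFrdI2008, Rem. 4.5.1 p.86]: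

> "We observe in passing that it is immediate from the definitions that if `C` is of rationally standard
> type (respectively, of standard type), then so is `C^istr`."

PROOF-ONLY companion (seat abc-iut-w4-d109; the standard-type half is `PreFrobenioid.isOfStandardType_istr`,
`Cor412OfFSMType.lean` / `IstrStandardTypeProofs.lean`; this file supplies the Def. 4.5 (ii) "rational type"
half, the last named input `hratI` of the [FrdI] Thm. 4.9 assembly `FrdI.T49.thm49_ofFunctor_of_isOfFSMType`).
"Immediate from the definitions", spelled out for THE birationalization (`PreFrobenioid.biratData`, rational
functions `PreFrobenioid.biratSubgroup`, seat abc-iut-L1-t5) and THE support predicate `PrimarySupp` of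
Def. 2.4 (i)(d) (`Prop55SubRatStdSlot.lean`), over the isotropic full subcategory `C^istr = PreFrobenioid.Istr F`
(structure functor `istrFunctor F`, the SAME divisor monoid `Φ` on the SAME base `D`):

* `pull_invDiv_hullMor` — for a base-isomorphism `δ : Y → A`, `Base(A → A^istr)^* ((δ^istr)⁻¹_* Div δ^istr)
  = δ⁻¹_* Div δ` (Prop. 1.9 (v): `Base`/`Div` of `δ^istr = hullMor δ`, `base_hullMor`, `div_hullMor`);
* `biratGerms_subset_biratSubgroup_istr`, **`biratSubgroup_le_biratSubgroup_istr`** — `Φ^birat_C(X) ⊆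
  Φ^birat_{C^istr}(X)` for every `X ∈ Ob(D)`: the isotropification functor carries a pair of base-equivalent
  pre-steps `(δ₁, δ₂ : Y → A)` to such a pair `(δ₁^istr, δ₂^istr)` of `C^istr` whose germ pulls back along
  `Base(A → A^istr)` to the germ of `(δ₁, δ₂)`, and `Φ^birat_C` is the SMALLEST pull-back-stable subfunctor
  containing the germs (`biratSubfunctor_le`);
* `isStrictlyRational_hullIstr` — if `B` is strictly rational in `C` then its hull `B^istr` is strictly
  rational in `C^istr` (transport along the base isomorphism `Base B ≅ Base B^istr`: primes and supports by
  `Primes.congr` / `primarySupp_map_mulEquiv_iff`, witnesses by pull-back stability and the inclusion above);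
* **`isRational_istr_of`** — Def. 4.5 (ii) for `C^istr` from `C`: a strictly rational pull-back source
  `ψ : B → X` of an isotropic `X` gives the pull-back morphism `ψ^istr : B^istr → X^istr ≅ X` of `C^istr`
  (`isPullbackMorphism_isotropification_map`, Prop. 1.9 (v)) with strictly rational domain.

No new definitions; no statement of the paper is strengthened; nothing here bears on [IUTchIII] Cor. 3.12.
-/

namespace Literature.AlgebraicGeometry.Frobenioids

namespace PreFrobenioid

open CategoryTheory Opposite

universe w v v' u u'

variable {D : Type u} [Category.{v} D] {Φ : Dᵒᵖ ⥤ CommMonCat.{w}} {C : Type u'} [Category.{v'} C]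
  {F : C ⥤ ElemFrobenioid Φ}

/-! ### `invDiv` along the isotropification functor -/

/-- For a base-isomorphism `δ : Y → A` of `C`, the element `(δ^istr)⁻¹_* Div(δ^istr) ∈ Φ(Base A^istr)` of the
image `δ^istr = hullMor δ : Y^istr → A^istr` pulls back along `Base(A → A^istr)` to `δ⁻¹_* Div(δ) ∈ Φ(Base A)`
(`Base(δ^istr) = Base(hull_Y)⁻¹ ≫ Base δ ≫ Base(hull_A)`, `Div(δ^istr) = Base(hull_Y)⁻¹^* Div δ`, Prop. 1.9 (v)).
[cite: MochizukiFrdI2008, Prop. 1.9 (v) p.33] -/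
theorem pull_invDiv_hullMor (hF : IsFrobenioid F) {Y A : C} (δ : Y ⟶ A) (h : IsBaseIso F δ)
    (h' : IsBaseIso F (hullMor hF δ)) :
    pull Φ (Base F (hullHom hF A)) (invDiv F (hullMor hF δ) h') = invDiv F δ h := by
  haveI : IsIso (Base F δ) := h
  haveI : IsIso (Base F (hullHom hF Y)) := (isIsotropicHull_hullHom hF Y).2.1.2
  haveI : IsIso (Base F (hullHom hF A)) := (isIsotropicHull_hullHom hF A).2.1.2
  -- compare after pulling back along the base-isomorphism `Base δ`
  apply Frobenioids.pull_injective_of_isIso Φ (Base F δ)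
  rw [pull_invDiv, ← pull_comp]
  -- `Base(hull_Y)⁻¹^*` of both sides: the defining identity of `invDiv (δ^istr)` and `div_hullMor`
  apply Frobenioids.pull_injective_of_isIso Φ (inv (Base F (hullHom hF Y)))
  rw [← pull_comp, ← base_hullMor hF δ, pull_invDiv, div_hullMor]

/-! ### `Φ^birat` of `C` is contained in `Φ^birat` of `C^istr` -/

/-- The birational germs of `C` at `A` lie in `Φ^birat_{C^istr}(Base A)`: the germ of a base-equivalent pair
`(δ₁, δ₂ : Y → A)` is the pull-back along `Base(A → A^istr)` of the germ of `(δ₁^istr, δ₂^istr)`, a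
base-equivalent pair of pre-steps of `C^istr` (`δ₁^istr` co-angular: every arrow of `C^istr` into the hull is,
Prop. 1.4 (i)). [cite: MochizukiFrdI2008, Rem. 4.5.1 p.86] -/
theorem biratGerms_subset_biratSubgroup_istr (hF : IsFrobenioid F) (A : C) :
    biratGerms F A ⊆ (biratSubgroup (istrFunctor F) (baseObj F A) : Set _) := by
  rintro _ ⟨Y, δ₁, δ₂, h₁, h₂, hb, rfl⟩
  -- the images `δ_i^istr : Y^istr → A^istr` in `C^istr`
  have h₁' : IsCoAngularPreStep (istrFunctor F) ((isotropification hF).map δ₁) :=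
    (isCoAngularPreStep_istr_iff hF _).2 ⟨isCoAngular_hullMor hF δ₁, isPreStep_hullMor hF δ₁ h₁.2⟩
  have h₂' : IsPreStep (istrFunctor F) ((isotropification hF).map δ₂) :=
    (isPreStep_istr_iff _).2 (isPreStep_hullMor hF δ₂ h₂)
  have hb' : BaseEquivalent (istrFunctor F) ((isotropification hF).map δ₁) ((isotropification hF).map δ₂) := by
    change Base F (hullMor hF δ₁) = Base F (hullMor hF δ₂)
    rw [base_hullMor, base_hullMor, show Base F δ₁ = Base F δ₂ from hb]
  -- their germ lies in `Φ^birat_{C^istr}(Base A^istr)`; pull it back along `Base(A → A^istr)`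
  have hmem := (biratSubfunctor (istrFunctor F)).pull_mem (Base F (hullHom hF A))
    (div_invDiv_mem_biratSubfunctor (istrFunctor F) _ _ h₁' h₂' hb')
  have hbi₁ : IsBaseIso F δ₁ := h₁.2.2
  have hbi₂ : IsBaseIso F δ₂ := h₂.2
  have hbi₁' : IsBaseIso F (hullMor hF δ₁) := h₁'.2.2
  have hbi₂' : IsBaseIso F (hullMor hF δ₂) := h₂'.2
  -- the same membership, read with plainly typed ends (`(δ^istr)⁻¹_* Div` computed in `C`, `invDiv_istr`)
  have hmem' : pullGp Φ (Base F (hullHom hF A))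
      (Algebra.GrothendieckGroup.of (invDiv F (hullMor hF δ₁) hbi₁') /
        Algebra.GrothendieckGroup.of (invDiv F (hullMor hF δ₂) hbi₂')) ∈
      biratSubgroup (istrFunctor F) (baseObj F A) := hmem
  have heq : pullGp Φ (Base F (hullHom hF A))
      (Algebra.GrothendieckGroup.of (invDiv F (hullMor hF δ₁) hbi₁') /
        Algebra.GrothendieckGroup.of (invDiv F (hullMor hF δ₂) hbi₂')) =
      Algebra.GrothendieckGroup.of (invDiv F δ₁ hbi₁) / Algebra.GrothendieckGroup.of (invDiv F δ₂ hbi₂) := by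
    rw [map_div, pullGp_of, pullGp_of]
    exact congrArg₂ (· / ·) (congrArg _ (pull_invDiv_hullMor hF δ₁ hbi₁ hbi₁'))
      (congrArg _ (pull_invDiv_hullMor hF δ₂ hbi₂ hbi₂'))
  exact heq ▸ hmem'

/-- **`Φ^birat_C(X) ⊆ Φ^birat_{C^istr}(X)`** for every `X ∈ Ob(D)` (`Φ^birat_C` is generated, as a
pull-back-stable subfunctor, by the germs, which lie in `Φ^birat_{C^istr}`).
[cite: MochizukiFrdI2008, Rem. 4.5.1 p.86] -/
theorem biratSubgroup_le_biratSubgroup_istr (hF : IsFrobenioid F) (X : D) :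
    biratSubgroup F X ≤ biratSubgroup (istrFunctor F) X :=
  biratSubfunctor_le F (biratSubfunctor (istrFunctor F)) (biratGerms_subset_biratSubgroup_istr hF) X

/-! ### Strict rationality and rationality pass to `C^istr` -/

/-- If `B ∈ Ob(C)` is strictly rational (Def. 4.5 (ii), at THE birationalization and the support `PrimarySupp`),
then so is its isotropic hull `B^istr ∈ Ob(C^istr)`: transport the witnesses along the base isomorphism
`Base B ≅ Base B^istr` of the hull. [cite: MochizukiFrdI2008, Rem. 4.5.1 p.86] -/
theorem isStrictlyRational_hullIstr (hF : IsFrobenioid F) {hsq : HasBiratSquares F}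
    {hsqI : HasBiratSquares (istrFunctor F)} {B : C}
    (hB : PreFrobenioidData.IsStrictlyRational (biratData hF hsq) (S := PreFrobenioidData.ofFunctor Φ F)
      (fun a 𝔭 => PrimarySupp a 𝔭) B) :
    PreFrobenioidData.IsStrictlyRational (biratData (isFrobenioid_istr hF) hsqI)
      (S := PreFrobenioidData.ofFunctor Φ (istrFunctor F)) (fun a 𝔭 => PrimarySupp a 𝔭) (hullIstr hF B) := by
  haveI : IsIso (Base F (hullHom hF B)) := (isIsotropicHull_hullHom hF B).2.1.2
  -- `ε : Φ(Base B) ≃ Φ(Base B^istr)`, the pull-back along `Base(hull_B)⁻¹`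
  obtain ⟨ε, hε⟩ := (PreFrobenioidData.ofFunctor Φ F).exists_pull_mulEquiv
    (asIso (Base F (hullHom hF B))).symm
  intro 𝔮
  change Primes (Φ.obj (op (baseObj F (hullObj hF B)))) at 𝔮
  obtain ⟨a, b, hab, ha, hb⟩ := hB (Primes.congr ε.symm 𝔮)
  change ↥(Φ.obj (op (baseObj F B))) at a b
  change Algebra.GrothendieckGroup.of a / Algebra.GrothendieckGroup.of b ∈ biratSubgroup F (baseObj F B) at hab
  change PrimarySupp a _ at ha
  change ¬ PrimarySupp b _ at hb
  have h𝔮 : Primes.congr ε (Primes.congr ε.symm 𝔮) = 𝔮 := Primes.congr_apply_congr_symm ε 𝔮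
  refine ⟨ε a, ε b, ?_, ?_, ?_⟩
  · -- `of (ε a) / of (ε b)` is the pull-back of `a − b` along `Base(hull_B)⁻¹`, in `Φ^birat_C ⊆ Φ^birat_{C^istr}`
    change Algebra.GrothendieckGroup.of (ε a) / Algebra.GrothendieckGroup.of (ε b) ∈
      biratSubgroup (istrFunctor F) (baseObj F (hullObj hF B))
    have h := (biratSubfunctor F).pull_mem (inv (Base F (hullHom hF B))) hab
    have heq : pullGp Φ (inv (Base F (hullHom hF B)))
        (Algebra.GrothendieckGroup.of a / Algebra.GrothendieckGroup.of b) =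
        Algebra.GrothendieckGroup.of (ε a) / Algebra.GrothendieckGroup.of (ε b) := by
      rw [map_div, pullGp_of, pullGp_of, hε, hε]
      rfl
    exact biratSubgroup_le_biratSubgroup_istr hF _ (heq ▸ h)
  · change PrimarySupp (ε a) 𝔮
    rw [← h𝔮]
    exact (primarySupp_map_mulEquiv_iff ε a _).2 ha
  · change ¬ PrimarySupp (ε b) 𝔮
    rw [← h𝔮]
    exact fun h => hb ((primarySupp_map_mulEquiv_iff ε b _).1 h)

/-- **Remark 4.5.1, rational-type half: Def. 4.5 (ii) passes from `C` to `C^istr`** (at THE birationalizations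
and the support `PrimarySupp`): if every object of `C` is rational then so is every object `X` of `C^istr` — a
strictly rational pull-back source `ψ : B → X` in `C` gives the pull-back morphism `ψ^istr : B^istr → X^istr` of
`C^istr` (Prop. 1.9 (v)), composed with the isomorphism `X^istr ≅ X` (the hull of an isotropic object), whose
domain `B^istr` is strictly rational. [cite: MochizukiFrdI2008, Rem. 4.5.1 p.86] -/
theorem isRational_istr_of (hF : IsFrobenioid F) {hsq : HasBiratSquares F}
    {hsqI : HasBiratSquares (istrFunctor F)}
    (hrat : ∀ A : C, PreFrobenioidData.IsRational (biratData hF hsq) (S := PreFrobenioidData.ofFunctor Φ F)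
      (fun a 𝔭 => PrimarySupp a 𝔭) A)
    (X : Istr F) :
    PreFrobenioidData.IsRational (biratData (isFrobenioid_istr hF) hsqI)
      (S := PreFrobenioidData.ofFunctor Φ (istrFunctor F)) (fun a 𝔭 => PrimarySupp a 𝔭) X := by
  obtain ⟨B, ψ, hψ, hB⟩ := hrat X.obj
  have hψ' : IsPullbackMorphism F ψ := (PreFrobenioidData.ofFunctor_isPullbackMorphism F ψ).mp hψ
  -- `X^istr ≅ X` in `C^istr` (the hull of the isotropic `X` is an isomorphism)
  let i : (isotropification hF).obj X.obj ≅ X := (isotropificationRestrictIso hF).app X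
  refine ⟨hullIstr hF B, (isotropification hF).map ψ ≫ i.hom, ?_, isStrictlyRational_hullIstr hF hB⟩
  exact (PreFrobenioidData.ofFunctor_isPullbackMorphism (istrFunctor F) _).mpr
    (IsPullbackMorphism.comp (istrFunctor F) (isPullbackMorphism_isotropification_map hF ψ hψ')
      (isPullbackMorphism_of_isIso (istrFunctor F) i.hom))

end PreFrobenioid

end Literature.AlgebraicGeometry.Frobenioids
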